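import Summits.QuantumFields.YangMills.Theorems.SwapVirialDeficitBlowUpVirialFollowersShare
import Summits.QuantumFields.YangMills.Theorems.SwapVirialDeficitBlowUpGnomonicLeadersWeight
import HarnessLib

/-!
# The `z`-LETTER'S SHARE of the virial window row is FREE: `½K_L⟪W(z)⟫_{000,b} ≤ 3600·L⁶·E₀(b)`, hence `O(L^{10} log b/b)·Z₀(b)` uniformly in `L`
# (free-hands support of ⟨stmt-QuantumFields-24197⟩ `SwapVirialDeficit.SwapGluedStiffness`; sharpening of the residue (LW) of the V2′ reduction chain)

The leaders' Euler weight `W_L = gnoWtr(x) + gnoWtr(y) + gnomonicW(z)` carries the valley term of ⟨24197⟩ (hLW of ✓`principalStiffness_of_leadersWindow` ∕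
✓`swapGluedStiffness_of_leadersValley_and_minus`).  Of its three letters only `x, y` are HUB-SOFT; the `z` letter (the relative position of the slaved leader) has FULL
stiffness: w2 g57's pointwise ✓`gnomonicW_z_le`: `gnomonicW(η_z) ≤ 7200·L⁶·F̂` (principal sector, hub `a ≠ 0`).  Exactly as for the followers
(✓`followersW_term_le_meanDeficit` ∕ ✓`followersW_term_apriori`), its share of `½K_L⟪W⟫` is therefore dominated by the mean deficit, uniformly in `L`:
* §1 `integrable_zW_fibre`, `integrable_fibre_zW`, `zW_fibre_le` (`∫ W(z)e^{−bF̂}ρ ≤ 7200L⁶ ∫ F̂e^{−bF̂}ρ` per fibre, `a ≠ 0`);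
* §2 ★★ `zW_term_le_meanDeficit` (`½K_L⟪W(z)⟫_{000,b} ≤ 3600·L⁶·E₀(b)`, cone-a.e. `a ≠ 0`), ★★★ `zW_term_apriori`
  (`≤ 3600·L⁶·(2(9L⁴−1)log b + K·L⁴(1+log L))/b · Z₀(b)` for all `L`, `b ≥ β₀`, ✓`swap_meanDeficit_apriori`).
So the residue (LW) concerns the TWO hub-soft letters `x, y` (stiffness `sin²2ψ`, `sin²ψ` in the hub angle `ψ`, ✓`leadersW_hubStiff_le`) and the remainder `R` only.
HONEST LABEL: one more share of one side, uniformly in `L`; (LW) ∕ (M) ∕ ⟨24197⟩ ∕ ⟨24194⟩ ∕ ⟨24196⟩ ∕ ⟨24497⟩ OPEN; the Yang–Mills mass gap is NOT proved; no summit is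
proved by a line.  Seat ym-line-fcl-p3 g46 (cell ym-idea-1, free hands; item of record ⟨24085⟩ aside, untouched), `--supports stmt-QuantumFields-24197`.
THEOREMS ONLY, 0 `sorry`, standard axioms; the series' local `ℍ` instances.  References: [cite: Luscher1983, §2]; [cite: Griffiths1964]; [folklore].
-/

set_option autoImplicit false
set_option synthInstance.maxSize 1024

noncomputable section

open MeasureTheory Quaternion Set Filter Topology
open scoped Quaternion BigOperators
open Literature.MathematicalPhysics.QuantumLattice
open Literature.MathematicalPhysics.QuantumFieldTheory hiding SU2
open Summit.QuantumFields.YangMills.Theorems.FemtoTransferGap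
open Summit.QuantumFields.YangMills.Theorems.FemtoTransferGap.TT
open Summit.QuantumFields.YangMills.Theorems.VirialFluxGap.RingDeficit
open Summit.QuantumFields.YangMills.Theorems.SwapTwistDeficit.ToronLog (coneMeasure coneConst coneConst_pos isProbabilityMeasure_coneMeasure)
open Summit.QuantumFields.YangMills.Theorems.SwapVirialDeficit.SwapRing
open Summit.QuantumFields.YangMills.Theorems.SwapVirialDeficit.Gnomonic (gnomonicW gnomonicW_nonneg_le)
open Summit.QuantumFields.YangMills.Theorems.SwapVirialDeficit.ZeroModeSigma (ae_ne_zero_coneMeasure)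

attribute [local instance] Literature.Analysis.FluidPDE.Tao2016.quatMeasurableSpace
  Literature.Analysis.FluidPDE.Tao2016.quatBorelSpace
  Literature.MathematicalPhysics.QuantumLattice.secondCountableTopology_su2

namespace Summit.QuantumFields.YangMills.Theorems.SwapVirialDeficit.BlowUpRing

variable {L : ℕ} [NeZero L]

/-! ## §1 Fibrewise -/

omit [NeZero L] in
/-- `W(z)` is measurable on `GnoCoord L`. [folklore] -/
theorem measurable_zW : Measurable fun η : GnoCoord L => gnomonicW η.2.1 :=
  continuous_gnomonicW.measurable.comp (measurable_fst.comp measurable_snd)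

/-- The `z`-letter weight fibre integrand is integrable (`0 ≤ W(z) ≤ 4`). [folklore] -/
theorem integrable_zW_fibre (z : Fin 3 → Bool) (a : ℍ) (ε : GnoSign L) {b : ℝ} (hb : 0 ≤ b) :
    Integrable fun η : GnoCoord L => gnomonicW η.2.1 * Real.exp (-(b * gnoDeficit z (fun _ => 1) a ε η)) * gnoDensity η := by
  refine (integrable_gnoDensity.const_mul 4).mono'
    ((measurable_zW.mul (((measurable_gnoDeficit z _ a ε).const_mul b).neg.exp)).mul measurable_gnoDensity).aestronglyMeasurable (ae_of_all _ fun η => ?_)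
  obtain ⟨h0, h4⟩ := gnomonicW_nonneg_le η.2.1
  rw [Real.norm_eq_abs, abs_mul, abs_mul, abs_of_nonneg h0, abs_of_pos (gnoDensity_pos η)]
  have h1 := abs_exp_gnoDeficit_le_one z (fun _ => (1 : SU2)) a ε hb η
  calc gnomonicW η.2.1 * |Real.exp (-(b * gnoDeficit z (fun _ => 1) a ε η))| * gnoDensity η ≤ 4 * 1 * gnoDensity η :=
        mul_le_mul_of_nonneg_right (mul_le_mul h4 h1 (abs_nonneg _) (by norm_num)) (gnoDensity_pos η).le
    _ = 4 * gnoDensity η := by rw [mul_one]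

/-- The `z`-letter weight functional `a ↦ Σ_ε ∫ W(z) e^{−bF̂}ρ` is cone-integrable. [folklore] -/
theorem integrable_fibre_zW (z : Fin 3 → Bool) {b : ℝ} (hb : 0 ≤ b) :
    Integrable (fun a : ℍ => ∑ ε : GnoSign L, ∫ η : GnoCoord L,
      gnomonicW η.2.1 * Real.exp (-(b * gnoDeficit z (fun _ => 1) a ε η)) * gnoDensity η) coneMeasure :=
  integrable_sum_fibre z (fun _ => 1) (g := fun _ p => gnomonicW p.2.2.1) (fun _ => (measurable_zW.comp measurable_snd).aemeasurable) (M := 4)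
    (fun _ p => by obtain ⟨h0, h1⟩ := gnomonicW_nonneg_le p.2.2.1; rw [abs_of_nonneg h0]; exact h1) hb

/-- ★ Fibrewise `z`-letter bound (hub `a ≠ 0`): `∫ W(z) e^{−bF̂₀}ρ ≤ 7200·L⁶·∫ F̂₀ e^{−bF̂₀}ρ` (✓`gnomonicW_z_le`). [cite: Luscher1983, §2] -/
theorem zW_fibre_le {a : ℍ} (ha : a ≠ 0) (ε : GnoSign L) {b : ℝ} (hb : 0 < b) :
    ∫ η : GnoCoord L, gnomonicW η.2.1 * Real.exp (-(b * gnoDeficit (fun _ => false) (fun _ => 1) a ε η)) * gnoDensity η ≤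
      7200 * (L : ℝ) ^ 6 *
        ∫ η : GnoCoord L, gnoDeficit (fun _ => false) (fun _ => 1) a ε η * Real.exp (-(b * gnoDeficit (fun _ => false) (fun _ => 1) a ε η)) *
          gnoDensity η := by
  rw [← integral_const_mul]
  refine integral_mono (integrable_zW_fibre _ a ε hb.le) ((integrable_gnoDeficit_fibre a ε _ hb).const_mul _) fun η => ?_
  have h := gnomonicW_z_le (L := L) ha ε η
  have hE := (Real.exp_pos (-(b * gnoDeficit (fun _ => false) (fun _ => (1 : SU2)) a ε η))).le
  have hρ := (gnoDensity_pos η).le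
  show gnomonicW η.2.1 * Real.exp (-(b * gnoDeficit (fun _ => false) (fun _ => 1) a ε η)) * gnoDensity η ≤
    7200 * (L : ℝ) ^ 6 * (gnoDeficit (fun _ => false) (fun _ => 1) a ε η * Real.exp (-(b * gnoDeficit (fun _ => false) (fun _ => 1) a ε η)) *
      gnoDensity η)
  rw [show 7200 * (L : ℝ) ^ 6 * (gnoDeficit (fun _ => false) (fun _ => 1) a ε η * Real.exp (-(b * gnoDeficit (fun _ => false) (fun _ => 1) a ε η)) *
      gnoDensity η) = (7200 * (L : ℝ) ^ 6 * gnoDeficit (fun _ => false) (fun _ => 1) a ε η) *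
        Real.exp (-(b * gnoDeficit (fun _ => false) (fun _ => 1) a ε η)) * gnoDensity η by ring]
  exact mul_le_mul_of_nonneg_right (mul_le_mul_of_nonneg_right h hE) hρ

/-! ## §2 On the ring, and uniformly in `L` -/

/-- ★★ **THE `z`-LETTER'S SHARE OF `½⟪W⟫` IS DOMINATED BY THE MEAN DEFICIT**: principal sector, every `L`, every `b > 0`,
`½·K_L·∫_cone Σ_ε ∫ W(z) e^{−bF̂₀}ρ ≤ 3600·L⁶·∫ F^S_0 e^{−bF^S_0} dμ_L` (hub `a ≠ 0` cone-a.e., ✓`integral_swapDeficit_exp_eq_gnomonic`). [cite: Luscher1983, §2] -/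
theorem zW_term_le_meanDeficit {b : ℝ} (hb : 0 < b) :
    1 / 2 * ((coneConst ^ 3 / 64 * (1 / (2 * Real.pi ^ 2)) ^ Fintype.card (Fol L)) *
        ∫ a, (∑ ε : GnoSign L, ∫ η : GnoCoord L,
          gnomonicW η.2.1 * Real.exp (-(b * gnoDeficit (fun _ => false) (fun _ => 1) a ε η)) * gnoDensity η) ∂coneMeasure) ≤
      3600 * (L : ℝ) ^ 6 * ∫ p, swapRingDeficit L (fun _ => false) p * Real.exp (-(b * swapRingDeficit L (fun _ => false) p)) ∂(ringMeasure L) := by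
  rw [integral_swapDeficit_exp_eq_gnomonic (fun _ => false) hb.le]
  have hK : (0 : ℝ) ≤ coneConst ^ 3 / 64 * (1 / (2 * Real.pi ^ 2)) ^ Fintype.card (Fol L) := by have := coneConst_pos; positivity
  have hmono : ∫ a, (∑ ε : GnoSign L, ∫ η : GnoCoord L,
        gnomonicW η.2.1 * Real.exp (-(b * gnoDeficit (fun _ => false) (fun _ => 1) a ε η)) * gnoDensity η) ∂coneMeasure ≤
      ∫ a, (7200 * (L : ℝ) ^ 6 * ∑ ε : GnoSign L, ∫ η : GnoCoord L,
        gnoDeficit (fun _ => false) (fun _ => 1) a ε η * Real.exp (-(b * gnoDeficit (fun _ => false) (fun _ => 1) a ε η)) * gnoDensity η) ∂coneMeasure := by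
    refine integral_mono_ae (integrable_fibre_zW _ hb.le) ((integrable_fibre_gnoDeficit _ _ hb).const_mul _) ?_
    filter_upwards [ae_ne_zero_coneMeasure] with a ha
    show (∑ ε : GnoSign L, ∫ η : GnoCoord L,
        gnomonicW η.2.1 * Real.exp (-(b * gnoDeficit (fun _ => false) (fun _ => 1) a ε η)) * gnoDensity η) ≤
      7200 * (L : ℝ) ^ 6 * ∑ ε : GnoSign L, ∫ η : GnoCoord L,
        gnoDeficit (fun _ => false) (fun _ => 1) a ε η * Real.exp (-(b * gnoDeficit (fun _ => false) (fun _ => 1) a ε η)) * gnoDensity η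
    rw [Finset.mul_sum]
    exact Finset.sum_le_sum fun ε _ => zW_fibre_le ha ε hb
  rw [integral_const_mul] at hmono
  have hL : (0 : ℝ) ≤ 7200 * (L : ℝ) ^ 6 := by positivity
  nlinarith [mul_le_mul_of_nonneg_left hmono hK]

/-- ★★★ **THE `z`-LETTER'S SHARE OF THE VIRIAL WINDOW ROW, UNIFORMLY IN `L`**: there are ABSOLUTE `K ≥ 0`, `β₀ ≥ 1` such that for every `L ≥ 1` and `b ≥ β₀`,
`½·K_L·∫_cone Σ_ε ∫ W(z) e^{−bF̂₀}ρ ≤ 3600·L⁶·(2(9L⁴−1)·log b + K·L⁴·(1+log L))/b · Z₀(b)` (`zW_term_le_meanDeficit` + ✓`swap_meanDeficit_apriori`)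
— `O(L^{10} log b/b)·Z₀`, negligible on every window `L ≤ b^a`, `a < 1/10`. [cite: Luscher1983, §2] [cite: Griffiths1964] -/
theorem zW_term_apriori :
    ∃ K : ℝ, 0 ≤ K ∧ ∃ β₀ : ℝ, 1 ≤ β₀ ∧ ∀ (L : ℕ) [NeZero L] (b : ℝ), β₀ ≤ b →
      1 / 2 * ((coneConst ^ 3 / 64 * (1 / (2 * Real.pi ^ 2)) ^ Fintype.card (Fol L)) *
          ∫ a, (∑ ε : GnoSign L, ∫ η : GnoCoord L,
            gnomonicW η.2.1 * Real.exp (-(b * gnoDeficit (fun _ => false) (fun _ => 1) a ε η)) * gnoDensity η) ∂coneMeasure) ≤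
        3600 * (L : ℝ) ^ 6 * ((2 * (9 * (L : ℝ) ^ 4 - 1) * Real.log b + K * (L : ℝ) ^ 4 * (1 + Real.log L)) / b) *
          ∫ p, Real.exp (-(b * swapRingDeficit L (fun _ => false) p)) ∂(ringMeasure L) := by
  obtain ⟨K, hK, β₀, hβ₀, h⟩ := swap_meanDeficit_apriori
  refine ⟨K, hK, β₀, hβ₀, fun L _ b hb => ?_⟩
  haveI := isProbabilityMeasure_ringMeasure (L := L)
  have hb0 : 0 < b := by linarith
  have h1 := zW_term_le_meanDeficit (L := L) hb0
  have h2 := h L b hb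
  have hZ : 0 < ∫ p, Real.exp (-(b * swapRingDeficit L (fun _ => false) p)) ∂(ringMeasure L) :=
    integral_exp_pos (integrable_exp_swapDeficit (L := L) (fun _ => false) b)
  have e1 : (fun p => Real.exp (-b * swapRingDeficit L (fun _ => false) p)) = fun p => Real.exp (-(b * swapRingDeficit L (fun _ => false) p)) := by
    funext p; rw [neg_mul]
  have e2 : (fun p => swapRingDeficit L (fun _ => false) p * Real.exp (-b * swapRingDeficit L (fun _ => false) p)) =
      fun p => swapRingDeficit L (fun _ => false) p * Real.exp (-(b * swapRingDeficit L (fun _ => false) p)) := by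
    funext p; rw [neg_mul]
  rw [e1, e2] at h2
  have hx := (le_div_iff₀' hb0).2 h2
  have h3 := (div_le_iff₀ hZ).1 hx
  have hL : (0 : ℝ) ≤ 3600 * (L : ℝ) ^ 6 := by positivity
  calc _ ≤ 3600 * (L : ℝ) ^ 6 * ∫ p, swapRingDeficit L (fun _ => false) p * Real.exp (-(b * swapRingDeficit L (fun _ => false) p)) ∂(ringMeasure L) := h1
    _ ≤ 3600 * (L : ℝ) ^ 6 * ((2 * (9 * (L : ℝ) ^ 4 - 1) * Real.log b + K * (L : ℝ) ^ 4 * (1 + Real.log L)) / b *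
          ∫ p, Real.exp (-(b * swapRingDeficit L (fun _ => false) p)) ∂(ringMeasure L)) := mul_le_mul_of_nonneg_left h3 hL
    _ = _ := by ring

end Summit.QuantumFields.YangMills.Theorems.SwapVirialDeficit.BlowUpRing

end
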